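import Mathlib
import Literature.RingTheory.CohomologyAnnihilator.Basic
import Literature.RingTheory.CohomologyAnnihilator.StableAnnihilation
import Literature.RingTheory.CohomologyAnnihilator.BirationalTransfer
import Literature.RingTheory.CohomologyAnnihilator.TowerBasic
import Summits.ResolutionOfSingularities.ResolutionOfSingularities.Theorems.HomologicalConductorPersistenceTwoStepTransferExponentTwo
import HarnessLib

/-!
# Retract engine: `(S)^{e+1} ⊆ caᵉ⁺³(R)` when `R` is a module retract of an algebra `P` with `caᵉ⁺³(P) = P`

Crux `HomologicalConductor.Persistence` (stmt-ResolutionOfSingularities-16484), chain W4.4b, rung L1;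
plan-1 ASSIGN v0.9 row «stub-3» (1) «exponent TWO at level 4: 𝔪_V² · T₁ ⊆ ca⁴(T₁) as a Theorems
file» (CHAIN v5 §V5.2 / CRUX-PLAN v5 §1.1, by-product (E1); statement of record tri-2
MERGE-WORDING). `[OURS · L1 w44b]` — elementary homological algebra, NOT a statement of the
manuscript under review and using none of its statements; AI-written (weaker than expert review).

This file is the ring-theoretic ENGINE; the Veronese cylinder `k[a,b,u]^{(1,1,0) mod 3}` is the
instance treated in `Theorems/HomologicalConductorPersistenceVeroneseExponentTwo.lean`.

## Setting and result

`R → P` commutative rings, `ρ : P → R` an `R`-linear retraction of the structure map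
(`ρ ∘ algebraMap = id`), `S ⊆ R` a set of elements each STABLY ANNIHILATING `P` as an `R`-module
(`c • 1_P = π ∘ ι` through a finite free `R`-module `Rˢ`) and `caᵉ⁺³(P) = P` (every finitely
generated `P`-module has projective dimension `≤ e + 2`; e.g. `P = k[x₁, …, x_{e+2}]` by Hilbert's
syzygy theorem, tree `cohomologyAnnihilatorOfDegree_mvPolynomial_eq_top`). Then

  `span_pow_le_cohomologyAnnihilatorOfDegree : (Ideal.span S)^{e+1} ≤ caᵉ⁺³(R)`.

The trivial bound is `(S)^{e+3} ⊆ caᵉ⁺³(R)` (`M` is a retract of `(P ⊗_R M)|_R`, which has a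
`P`-projective resolution of length `e + 2` by modules in `add_R(P)`); passing to SECOND syzygies
saves two powers, and this is the whole content:

* `exists_retract_ker_mulVecLin` — a second syzygy `X = ker (A : Rᵐ → Rⁿ)` over `R` is an
  `R`-linear retract of `K' = ker (A_P : Pᵐ → Pⁿ)` (embed by `algebraMap`, retract by `ρ`
  componentwise; `A` has entries in `R` and `ρ` is `R`-linear);
* `K'` is a second syzygy over `P`, so `pd_P K' ≤ e` (`HasProjectiveDimensionLT` bookkeeping along
  `0 → K' → Pᵐ → im → 0`, `0 → im → Pⁿ → coker → 0`);
* `pow_smul_ext_eq_zero_of_hasProjectiveDimensionLT` — if `pd_P K < e + 1` then `(S)^{e+1}` kills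
  `Ext^{≥ e+1}_R(K|_R, -)`: induction on `e` along `0 → K₁ → Pˢ → K → 0`; the free `P`-modules `Pˢ`
  and their `P`-retracts are `S`-stably annihilated over `R` with exponent ONE
  (`smul_ext_pi_eq_zero`, tree `smul_ext_eq_zero_of_linearMap_comp_eq_smul_id`), and each
  extension costs one factor (idea-1's `mul_smul_ext_X₃_eq_zero_of_shortExact`, p493645);
* `smul_ext_eq_zero_of_retract` + two dimension shifts over `R` finish.

With `e + 2 = 3 = dim k[a,b,u]` this is the «covariant two-step presentation of second syzygies»
of card A4 (idea-1) WITHOUT the Auslander algebra `S′∗G` (no invertibility of `|G|` is needed: the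
retraction used downstream is a graded projection, not an average).
-/

-- single-problem summit: the doubled namespace component is forced
set_option linter.dupNamespace false

noncomputable section

open CategoryTheory CategoryTheory.Abelian

universe u

namespace Summit.ResolutionOfSingularities.ResolutionOfSingularities.Theorems.HomologicalConductor.PersistenceRetractEngine

open Literature.RingTheory.CohomologyAnnihilator
open Summit.ResolutionOfSingularities.ResolutionOfSingularities.Theorems.HomologicalConductor.PersistenceTwoStepTransferExponentTwo

/-! ## Engine: stable annihilation of `P|_R` and second syzygies -/

section Engine

variable {R : Type u} [CommRing R]

/-- Retracts inherit annihilation of `Ext`: if `r ∘ i = id_K` (`R`-linear, `K` a retract of `Y`)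
and `c` kills `Extʲ_R(Y, N)`, then `c` kills `Extʲ_R(K, N)`. [folklore] -/
theorem smul_ext_eq_zero_of_retract {K Y : Type u} [AddCommGroup K] [Module R K]
    [AddCommGroup Y] [Module R Y] (i : K →ₗ[R] Y) (r : Y →ₗ[R] K) (hri : r ∘ₗ i = LinearMap.id)
    {c : R} {N : ModuleCat.{u} R} {j : ℕ}
    (hY : ∀ e : Ext.{u} (ModuleCat.of R Y) N j, c • e = 0)
    (e : Ext.{u} (ModuleCat.of R K) N j) : c • e = 0 := by
  have hir : ModuleCat.ofHom i ≫ ModuleCat.ofHom r = 𝟙 (ModuleCat.of R K) := by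
    rw [← ModuleCat.ofHom_comp, hri]
    rfl
  have he : e = (Ext.mk₀ (ModuleCat.ofHom i)).comp
      ((Ext.mk₀ (ModuleCat.ofHom r)).comp e (zero_add j)) (zero_add j) := by
    rw [Ext.mk₀_comp_mk₀_assoc, hir, Ext.mk₀_id_comp]
  rw [he, ← Ext.comp_smul, hY, Ext.comp_zero]

variable {P : Type u} [CommRing P] [Algebra R P]

/-- If `c • 1_P` factors through a finite free `R`-module (`π ∘ ι = c • id`, `R`-linear), then
`c` kills `Extⁱ_R(Pᵗ, N)` for every `t`, every `R`-module `N` and every `i ≥ 1`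
(`c • 1_{Pᵗ}` factors through the free module `(Rˢ)ᵗ`). [folklore] -/
theorem smul_ext_pi_eq_zero {c : R} {s : ℕ} (ι : P →ₗ[R] (Fin s → R))
    (π : (Fin s → R) →ₗ[R] P) (h : π ∘ₗ ι = c • LinearMap.id) (t : ℕ) (N : ModuleCat.{u} R)
    {i : ℕ} (hi : 1 ≤ i) (e : Ext.{u} (ModuleCat.of R (Fin t → P)) N i) : c • e = 0 := by
  refine smul_ext_eq_zero_of_linearMap_comp_eq_smul_id (P := Fin t → Fin s → R)
    (ι.compLeft (Fin t)) (π.compLeft (Fin t)) ?_ N hi e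
  refine LinearMap.ext fun v => funext fun a => ?_
  have hv : π (ι (v a)) = c • v a := LinearMap.congr_fun h (v a)
  simpa [LinearMap.compLeft] using hv

/-- The elements of the ideal generated by a set `S` of elements each of which stably annihilates
`P|_R` kill `Ext^{≥1}_R(Pᵗ, -)`. [folklore] -/
theorem smul_ext_pi_eq_zero_of_mem_span {S : Set R}
    (hS : ∀ c ∈ S, ∃ (s : ℕ) (ι : P →ₗ[R] (Fin s → R)) (π : (Fin s → R) →ₗ[R] P),
      π ∘ₗ ι = c • LinearMap.id)
    {c : R} (hc : c ∈ Ideal.span S) (t : ℕ) (N : ModuleCat.{u} R) {i : ℕ} (hi : 1 ≤ i)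
    (e : Ext.{u} (ModuleCat.of R (Fin t → P)) N i) : c • e = 0 := by
  induction hc using Submodule.span_induction generalizing e with
  | mem x hx =>
    obtain ⟨s, ι, π, h⟩ := hS x hx
    exact smul_ext_pi_eq_zero ι π h t N hi e
  | zero => exact zero_smul _ _
  | add x y _ _ hx hy => rw [add_smul, hx, hy, add_zero]
  | smul a x _ hx => rw [smul_eq_mul, mul_smul, hx, smul_zero]

/-- **Engine, inductive form.** Let `S ⊆ R` consist of elements stably annihilating `P|_R`. If a
finitely generated `P`-module `K` (with compatible `R`-structure) has projective dimension `< e + 1`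
over `P`, then every element of `(S)^{e+1}` kills `Extⁱ_R(K|_R, N)` for all `i ≥ e + 1`: induction
on `e` along a `P`-free presentation `0 → K₁ → Pˢ → K → 0`, using the `X₃`-direction dimension
shift `mul_smul_ext_X₃_eq_zero_of_shortExact`; the base case is a `P`-projective `K`, a retract of
some `Pᵗ`. [folklore] -/
theorem pow_smul_ext_eq_zero_of_hasProjectiveDimensionLT [IsNoetherianRing P] {S : Set R}
    (hS : ∀ c ∈ S, ∃ (s : ℕ) (ι : P →ₗ[R] (Fin s → R)) (π : (Fin s → R) →ₗ[R] P),
      π ∘ₗ ι = c • LinearMap.id)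
    (e : ℕ) :
    ∀ (K : Type u) [AddCommGroup K] [Module P K] [Module R K] [IsScalarTower R P K]
      [Module.Finite P K], HasProjectiveDimensionLT (ModuleCat.of P K) (e + 1) →
      ∀ x ∈ Ideal.span S ^ (e + 1), ∀ (N : ModuleCat.{u} R) (i : ℕ), e + 1 ≤ i →
        ∀ η : Ext.{u} (ModuleCat.of R K) N i, x • η = 0 := by
  induction e with
  | zero =>
    intro K _ _ _ _ _ hK x hx N i hi η
    rw [zero_add, pow_one] at hx
    -- `K` is `P`-projective, hence a retract of some `Pᵗ`
    haveI : Projective (ModuleCat.of P K) := inferInstance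
    haveI : Module.Projective P K := (ModuleCat.of P K).projective_of_module_projective
    obtain ⟨t, q, hq⟩ := Module.Finite.exists_fin' P K
    obtain ⟨sec, hsec⟩ := Module.projective_lifting_property q LinearMap.id hq
    refine smul_ext_eq_zero_of_retract (sec.restrictScalars R) (q.restrictScalars R) ?_
      (fun e' => smul_ext_pi_eq_zero_of_mem_span hS hx t N hi e') η
    ext k
    exact LinearMap.congr_fun hsec k
  | succ e ih =>
    intro K _ _ _ _ _ hK x hx N i hi η
    obtain ⟨s, q, hq⟩ := Module.Finite.exists_fin' P K
    -- the first `P`-syzygy `K₁ = ker q`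
    have hK₁fin : Module.Finite P (LinearMap.ker q) := Module.IsNoetherian.finite P _
    -- short exact over `P`: projective dimension of `K₁`
    obtain ⟨wP, hSP⟩ := exists_shortExact_of_linearMap (Y := ModuleCat.of P (LinearMap.ker q))
      (M := ModuleCat.of P (Fin s → P)) (X := ModuleCat.of P K) (LinearMap.ker q).subtype q
      (Submodule.injective_subtype _) hq (LinearMap.exact_subtype_ker_map q)
    have hK₁ : HasProjectiveDimensionLT (ModuleCat.of P (LinearMap.ker q)) (e + 1) :=
      (hSP.hasProjectiveDimensionLT_X₃_iff e
        (inferInstance : Projective (ModuleCat.of P (Fin s → P)))).mp hK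
    -- short exact over `R`
    obtain ⟨wR, hSR⟩ := exists_shortExact_of_linearMap (Y := ModuleCat.of R (LinearMap.ker q))
      (M := ModuleCat.of R (Fin s → P)) (X := ModuleCat.of R K)
      ((LinearMap.ker q).subtype.restrictScalars R) (q.restrictScalars R)
      (Submodule.injective_subtype _) hq (LinearMap.exact_subtype_ker_map q)
    obtain ⟨i, rfl⟩ : ∃ i', i = 1 + i' := ⟨i - 1, by omega⟩
    rw [pow_succ] at hx
    refine Submodule.mul_induction_on hx (fun y hy c hc => ?_) (fun a b ha hb => ?_)
    · exact mul_smul_ext_X₃_eq_zero_of_shortExact hSR rfl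
        (fun e' => smul_ext_pi_eq_zero_of_mem_span hS hc s N (by omega) e')
        (fun e' => ih (LinearMap.ker q) hK₁ y hy N i (by omega) e') η
    · rw [add_smul, ha, hb, add_zero]


/-! ### Second syzygies over `R` are retracts of second syzygies over `P` -/

/-- **Base change of a matrix kernel, and its retraction.** Let `ρ : P → R` be an `R`-linear
retraction of the structure map (`ρ ∘ algebraMap = id`). For a matrix `A` over `R` with base change
`A_P` over `P`, the kernel `ker A ⊆ Rᵐ` is an `R`-linear retract of `ker A_P ⊆ Pᵐ`: embed by
`algebraMap` componentwise, retract by `ρ` componentwise (`A (ρ ∘ v) = ρ (A_P v)` as `A` has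
entries in `R`). [folklore] -/
theorem exists_retract_ker_mulVecLin (ρ : P →ₗ[R] R) (hρ : ∀ r : R, ρ (algebraMap R P r) = r)
    {m n : ℕ} (A : Matrix (Fin n) (Fin m) R) :
    ∃ (i : LinearMap.ker A.mulVecLin →ₗ[R] LinearMap.ker (A.map (algebraMap R P)).mulVecLin)
      (r : LinearMap.ker (A.map (algebraMap R P)).mulVecLin →ₗ[R] LinearMap.ker A.mulVecLin),
      r ∘ₗ i = LinearMap.id := by
  have hi : ∀ x : Fin m → R, x ∈ LinearMap.ker A.mulVecLin →
      (fun j => algebraMap R P (x j)) ∈ LinearMap.ker (A.map (algebraMap R P)).mulVecLin := by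
    intro x hx
    rw [LinearMap.mem_ker, Matrix.mulVecLin_apply] at hx ⊢
    funext a
    rw [Pi.zero_apply, show (fun j => algebraMap R P (x j)) = ⇑(algebraMap R P) ∘ x from rfl,
      ← RingHom.map_mulVec, hx, Pi.zero_apply, map_zero]
  have hr : ∀ v : Fin m → P, v ∈ LinearMap.ker (A.map (algebraMap R P)).mulVecLin →
      (fun j => ρ (v j)) ∈ LinearMap.ker A.mulVecLin := by
    intro v hv
    rw [LinearMap.mem_ker, Matrix.mulVecLin_apply] at hv ⊢
    funext a
    have hva : Matrix.mulVec (A.map (algebraMap R P)) v a = 0 := by rw [hv, Pi.zero_apply]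
    simp only [Matrix.mulVec, dotProduct, Matrix.map_apply] at hva
    have hsum : ∑ j, A a j * ρ (v j) = ρ (∑ j, algebraMap R P (A a j) * v j) := by
      rw [map_sum]
      refine Finset.sum_congr rfl fun j _ => ?_
      rw [← Algebra.smul_def, map_smul, smul_eq_mul]
    simp only [Matrix.mulVec, dotProduct, Pi.zero_apply]
    rw [hsum, hva, map_zero]
  refine ⟨{ toFun := fun x => ⟨fun j => algebraMap R P (x.1 j), hi x.1 x.2⟩
            map_add' := fun x y => by
              ext j
              simp
            map_smul' := fun c x => by
              ext j
              simp [Algebra.smul_def] },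
          { toFun := fun v => ⟨fun j => ρ (v.1 j), hr v.1 v.2⟩
            map_add' := fun v w => by
              ext j
              simp
            map_smul' := fun c v => by
              ext j
              simp }, ?_⟩
  refine LinearMap.ext fun x => Subtype.ext (funext fun j => ?_)
  simp [hρ]

/-! ### The engine -/

/-- **Engine.** Let `R → P` be commutative noetherian rings such that the structure map has an
`R`-linear retraction `ρ` (`ρ ∘ algebraMap = id`), let `S ⊆ R` be a set of elements each of which
STABLY ANNIHILATES `P` as an `R`-module (`c • 1_P = π ∘ ι` through a finite free `R`-module), and
suppose `caᵉ⁺³(P) = P` (every finitely generated `P`-module has projective dimension `≤ e + 2`,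
e.g. `P` regular of dimension `e + 2`). Then `(S·R)^{e+1} ⊆ caᵉ⁺³(R)`.

Proof: a second syzygy `X = Ω²_R M = ker (A : Rᵐ → Rⁿ)` is an `R`-retract of `K' = ker (A_P)`
(`exists_retract_ker_mulVecLin`); `K'` is a second syzygy over `P`, so has projective dimension
`≤ e` over `P`; the inductive engine `pow_smul_ext_eq_zero_of_hasProjectiveDimensionLT` gives
`(S)^{e+1} · Ext^{≥ e+1}_R(K', -) = 0`, hence the same for the retract `X`, hence
`(S)^{e+1} · Ext^{≥ e+3}_R(M, -) = 0` by dimension shifting. With `e + 2 = dim P` this saves two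
powers over the trivial bound `(S)^{e+3} ⊆ caᵉ⁺³(R)` (from `M` being a retract of `(P ⊗_R M)|_R`).
[folklore] -/
theorem span_pow_le_cohomologyAnnihilatorOfDegree [IsNoetherianRing R] [IsNoetherianRing P]
    (ρ : P →ₗ[R] R) (hρ : ∀ r : R, ρ (algebraMap R P r) = r) {S : Set R}
    (hS : ∀ c ∈ S, ∃ (s : ℕ) (ι : P →ₗ[R] (Fin s → R)) (π : (Fin s → R) →ₗ[R] P),
      π ∘ₗ ι = c • LinearMap.id)
    (e : ℕ) (hP : cohomologyAnnihilatorOfDegree P (e + 3) = ⊤) :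
    Ideal.span S ^ (e + 1) ≤ cohomologyAnnihilatorOfDegree R (e + 3) := by
  intro y hy
  rw [mem_cohomologyAnnihilatorOfDegree_iff]
  intro i hi M N hM hN η
  haveI := hM
  -- two syzygies of `M` over `R`
  obtain ⟨n, f₀, hf₀⟩ := Module.Finite.exists_fin' R M
  have hΩfin : Module.Finite R (LinearMap.ker f₀) := Module.IsNoetherian.finite R _
  obtain ⟨m, g, hg⟩ := Module.Finite.exists_fin' R (LinearMap.ker f₀)
  set φ : (Fin m → R) →ₗ[R] (Fin n → R) := (LinearMap.ker f₀).subtype ∘ₗ g with hφ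
  set A : Matrix (Fin n) (Fin m) R := LinearMap.toMatrix' φ with hA
  have hAφ : A.mulVecLin = φ := by
    rw [← Matrix.toLin'_apply', hA, Matrix.toLin'_toMatrix']
  have hkerA : LinearMap.ker A.mulVecLin = LinearMap.ker g := by
    rw [hAφ, hφ, LinearMap.ker_comp_of_ker_eq_bot _ (Submodule.ker_subtype _)]
  -- the two short exact sequences over `R`
  obtain ⟨wa, hSa⟩ := exists_shortExact_of_linearMap (Y := ModuleCat.of R (LinearMap.ker f₀))
    (M := ModuleCat.of R (Fin n → R)) (X := M) (LinearMap.ker f₀).subtype f₀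
    (Submodule.injective_subtype _) hf₀ (LinearMap.exact_subtype_ker_map f₀)
  obtain ⟨wb, hSb⟩ := exists_shortExact_of_linearMap
    (Y := ModuleCat.of R (LinearMap.ker A.mulVecLin)) (M := ModuleCat.of R (Fin m → R))
    (X := ModuleCat.of R (LinearMap.ker f₀)) (LinearMap.ker A.mulVecLin).subtype g
    (Submodule.injective_subtype _) hg (by
      rw [LinearMap.exact_iff, Submodule.range_subtype, hkerA])
  -- peel off two degrees
  obtain ⟨j, rfl⟩ : ∃ j, i = j + 1 + 1 := ⟨i - 2, by omega⟩
  obtain ⟨η₁, rfl⟩ := precomp_extClass_surjective_of_projective_X₂ N hSa (j + 1) η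
  obtain ⟨η₂, rfl⟩ := precomp_extClass_surjective_of_projective_X₂ N hSb j η₁
  -- the base-changed kernel `K' = ker A_P` over `P` and its projective dimension `≤ e`
  set AP : Matrix (Fin n) (Fin m) P := A.map (algebraMap R P) with hAP
  have hK'fin : Module.Finite P (LinearMap.ker AP.mulVecLin) := Module.IsNoetherian.finite P _
  have hQ : HasProjectiveDimensionLT
      (ModuleCat.of P ((Fin n → P) ⧸ LinearMap.range AP.mulVecLin)) (e + 3) :=
    hasProjectiveDimensionLT_of_cohomologyAnnihilatorOfDegree_eq_top hP _
  obtain ⟨w₂, hS₂⟩ := exists_shortExact_of_linearMap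
    (Y := ModuleCat.of P (LinearMap.range AP.mulVecLin)) (M := ModuleCat.of P (Fin n → P))
    (X := ModuleCat.of P ((Fin n → P) ⧸ LinearMap.range AP.mulVecLin))
    (LinearMap.range AP.mulVecLin).subtype (LinearMap.range AP.mulVecLin).mkQ
    (Submodule.injective_subtype _) (Submodule.mkQ_surjective _) (LinearMap.exact_subtype_mkQ _)
  have hF₂ : HasProjectiveDimensionLT (ModuleCat.of P (Fin n → P)) (e + 2) :=
    hasProjectiveDimensionLT_of_ge _ 1 (e + 2) (by omega)
  have hIm : HasProjectiveDimensionLT (ModuleCat.of P (LinearMap.range AP.mulVecLin)) (e + 2) :=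
    hS₂.hasProjectiveDimensionLT_X₁ (e + 2) hF₂ hQ
  obtain ⟨w₁, hS₁⟩ := exists_shortExact_of_linearMap
    (Y := ModuleCat.of P (LinearMap.ker AP.mulVecLin)) (M := ModuleCat.of P (Fin m → P))
    (X := ModuleCat.of P (LinearMap.range AP.mulVecLin))
    (LinearMap.ker AP.mulVecLin).subtype AP.mulVecLin.rangeRestrict
    (Submodule.injective_subtype _) (LinearMap.surjective_rangeRestrict _) (by
      rw [LinearMap.exact_iff, LinearMap.ker_rangeRestrict, Submodule.range_subtype])
  have hF₁ : HasProjectiveDimensionLT (ModuleCat.of P (Fin m → P)) (e + 1) :=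
    hasProjectiveDimensionLT_of_ge _ 1 (e + 1) (by omega)
  have hK' : HasProjectiveDimensionLT (ModuleCat.of P (LinearMap.ker AP.mulVecLin)) (e + 1) :=
    hS₁.hasProjectiveDimensionLT_X₁ (e + 1) hF₁ hIm
  -- the engine on `K'`, transported to the retract `ker A = Ω² M`
  obtain ⟨ι, r, hrι⟩ := exists_retract_ker_mulVecLin ρ hρ A
  have h₂ : y • η₂ = 0 :=
    smul_ext_eq_zero_of_retract ι r hrι
      (fun e' => pow_smul_ext_eq_zero_of_hasProjectiveDimensionLT hS e
        (LinearMap.ker AP.mulVecLin) hK' y hy N j (by omega) e') η₂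
  -- push forward along the two (`R`-linear) connecting maps
  have h₁ : y • hSb.extClass.precomp N (add_comm 1 j) η₂ = 0 := by
    change y • (hSb.extClass.precompOfLinear R N (add_comm 1 j)) η₂ = 0
    rw [← LinearMap.map_smul, h₂, LinearMap.map_zero]
  change y • (hSa.extClass.precompOfLinear R N (add_comm 1 (j + 1)))
    (hSb.extClass.precomp N (add_comm 1 j) η₂) = 0
  rw [← LinearMap.map_smul, h₁, LinearMap.map_zero]

end Engine

end Summit.ResolutionOfSingularities.ResolutionOfSingularities.Theorems.HomologicalConductor.PersistenceRetractEngine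

end
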